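import Literature.MathematicalPhysics.QuantumFieldTheory.Balaban1983to89.Node00.OpsYSectDCoords
import Literature.MathematicalPhysics.QuantumFieldTheory.Balaban1983to89.B9Thm312Whole
import Literature.MathematicalPhysics.QuantumFieldTheory.Balaban1983to89.B9Thm37GlueTorusCov
import HarnessLib

/-!
# Route `UnitScaleTilt` (α), node N06(d = 3), layer 0 ∕ brick L0f — **`Identities 𝔬 U`, THE LETTER-SYMMETRY ROW AND `PosDefEnd (𝔬.S0 U)` FOR ANY LETTER RECORD PINNED TO
# pub-ymgap's κ-FOLD COORDINATE MODELS OF GENUINE LETTERS** — the T³-ready, letter-GENERIC twin of `Node00.OpsYSectDCoords` §6–§7 (def-Y g10, 2026-08-27, stated there at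
# def-Y's letters): for an abstract `𝔬 : B9Thm312Whole.Ops g B (SX × D × κ × κ) Y (SZ × D × κ × κ) (SW × D × κ × κ)` whose sixteen operator fields at `U` are PINNED (hypotheses, the
# BalabanUV knit's `hGco12` style, `Summits/…/BalabanUVNodesN06Thm312313AtPinsPairMB.lean` :136–138) to `c^{±1} • coordOpK(H) b (fun _ ↦ T.restrictScalars ℝ)` of GENUINE ℂ-linear
# letters `T` on `M_N(ℂ)`-valued lattice functions with the scalings of `OpsYSectDCoords` §5, ALL THIRTEEN fields of `Identities 𝔬 U` follow from the thirteen operator identities of the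
# genuine letters — INCLUDING the (3.124) triple `h124Q ∕ h124R ∕ hR` that `OpsYSectDCoords` could not supply at def-Y's comb averaging («located gap O5») and that the T³ route's
# intrinsic `N_S` (★★OWNER ACK 32 (q1)) DOES supply at ym-inputs-p01's letters (✓ `Prop7SectET3OpsT3HilbertRows.h124Q_row ∕ h124R_row ∕ hR_row`, p624046)

Cell `ym-inputs` (D-0154 (2); desk `ym-inputs-plan-1` INPUT-LIST v7 §4 row p05 = I-06 (d) «structural rows for `𝔬_T3`»; this seat's LOCATE memo `pub/ym-inputs/L0F-DEF-DESIGN-p05g2.md` §5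
«PRIOR ART: the κ-fold coordinate-model machinery exists; the L0f def is its T³ instance»), seat ym-inputs-p05 g2.  Count-neutral helper (`--supports stmt-QuantumFields-20520 --as helper`;
RULING g26-№2); registry untouched; THEOREMS ONLY (0 `def`, 0 `sorry`); pub-ymgap's `B9CoReadingCoords{,H,Transpose}` ∕ `Node00.OpsYSectDCoords` §1 functor calculus cited BY NAME,
nothing of theirs retyped; NOTHING of [Balaban1985BackgroundPropagators] is asserted.

THE PINS (`OpsYSectDCoords` §5 shapes, letter-generic; `K T := coordOpK b (fun _ : D ↦ T.restrictScalars ℝ)`, `KH` the two-carrier `coordOpKH`, a scalar `c ≠ 0` — pub-ymgap's `cR39 b`):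
`G0 = c•K g0`, `S0 = c⁻¹•K s0`, `Tpi = c⁻¹•K tpi`, `T2 = c⁻¹•K t2`, `G = c•K g`, `G1 = c•K g1`, `GG = c•K gg`, `Q = c⁻¹•KH q`, `Qstar = c⁻¹•KH qs`, `C = c•K cc`, `C1 = c•K c1`, `Hm = c•KH hm`,
`H1m = c•KH h1m`, `Dv = KH dv`, `Dvstar = KH dvs`, `R = c⁻¹•K r`.  At the T³ member the genuine letters are ym-inputs-p01's layer-0 letters read on the route carrier
(`toL2⁻¹ ∘ GT … ∘ toL2`, …; three Hessian slots), `b := trBasis 2`, `c := cR39 (trBasis 2)`; the operator identities are ✓ `Prop7SectET3OpsT3HilbertRows` transported by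
✓ `Prop7SectET3OpsT3ReadingRows.transport_comp_transport` — the instance is the definer's (`def 𝔬_T3` ∕ the knit's structure literal), not typed here.

WHAT IS PROVED (ns `…Theorems.Prop7SectET3OpsCoordPins`): §1 bookkeeping (`smul_comp_smul`, `coordOpKH_zero`∕`coordOpKH_id`, `restrictScalars` through `∘`∕`−`∕`+`; `isTransposePair_smul` is lit ✓`B9Thm37GlueTorusCov`'s); §2 ★★★ `identities_of_coordPins` — all
thirteen fields (`invG0'`∕`invG`∕`invG1`∕`eq126`∕`eq129`∕`eq153`∕`c1_inv`∕`h124Q`∕`h124R`∕`hR` over any basis `b` and `c ≠ 0`; `adjQ`∕`adjDv`∕`symmR` need `b` trace-orthonormal, `hb`,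
e.g. `trBasis_repr_eq_trace`); §3 ★★ `letterSymm_of_coordPins` — the row `hls` (`S0`, `Tpi`, `T2` self-transpose from `IsSymmTr 1`, `(D, Dstar)` a transpose pair from a direction-indexed
adjoint family `IsAdjTr 1 1 (d ν) (ds ν)`); §4 `dotProduct_coordOpK_eq_sum` (the quadratic form of a model = Σ over slices of trace pairings), ★ `posDefEnd_of_coordPin` — `PosDefEnd (c⁻¹ • K s0)` from `PosDefTr 1 s0` and `0 < c` (`FormSmall.posS0`, Thm 3.11's meaning).
HONEST SCOPE: finite-dimensional linear algebra (functoriality of `coordOpK(H)`, pub-ymgap's transpose dictionary); no letter is defined, no identity of print asserted (they are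
hypotheses on the genuine letters, theorems of layer 0 at T³); N06(d = 3) NOT discharged; nothing here claims EX, the crux, d = 4 or the mass gap; YM₃ on T³ is rung R3, not Clay.

References: T. Bałaban, CMP **99** (1985) 389–434 [Balaban1985BackgroundPropagators] ((3.120)–(3.130) pp.419–421, (3.124) p.420, (3.147) p.425, (3.152)–(3.153) p.426, Thm 3.11
p.416, p.391∕p.393 scalar products); CMP **96** (1984) 223–250 [Balaban1984PropagatorsII] ((2.51) p.232).
-/

set_option autoImplicit false

noncomputable section

open scoped Matrix Matrix.Norms.L2Operator

namespace Summit.QuantumFields.YangMills.Theorems.Prop7SectET3OpsCoordPins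

open Literature.MathematicalPhysics.QuantumFieldTheory.Balaban1983to89
open Literature.MathematicalPhysics.QuantumFieldTheory.Balaban1983to89.B9Thm37Glue (IsTransposePair)
open Literature.MathematicalPhysics.QuantumFieldTheory.Balaban1983to89.B9Thm312Whole (Ops frakPstar PosDefEnd Identities)
open B9CoReadingCoords (assembleK coordOpK coordOpK_apply coordOpK_comp)
open B9CoReadingCoordsH (coordOpKH coordOpKH_apply coordOpK_comp_coordOpKH)
open B9CoReadingCoordsTranspose (assembleK_pairing trReForm trReForm_apply sum_trReForm_eq_trIP isTransposePair_coordOpK_of_isSymmTr isTransposePair_coordOpK_of_isAdjTr)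
open B9Thm311ReadingCoords (trIP IsSymmTr IsAdjTr PosDefTr)
open B9Thm37GlueTorusCov (isTransposePair_smul)
open Node00.OpsYSectDCoords (coordOpK_id coordOpKH_eq_coordOpK coordOpKH_comp_coordOpK coordOpKH_comp_coordOpKH coordOpKH_sub coordOpKH_smul isTransposePair_coordOpKH_of_isAdjTr)

variable {N : ℕ} {κ : Type} [Fintype κ] [DecidableEq κ] {SX SZ SW D : Type}

/-! ## §1 Bookkeeping -/

section Book

variable {𝔸 : Type} [NormedRing 𝔸] [NormedAlgebra ℂ 𝔸] (b : Module.Basis κ ℝ 𝔸)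

/-- scalars of a composite of scaled maps. [folklore] -/
theorem smul_comp_smul {M₁ M₂ M₃ : Type} [AddCommGroup M₁] [Module ℝ M₁] [AddCommGroup M₂] [Module ℝ M₂] [AddCommGroup M₃] [Module ℝ M₃]
    (r s : ℝ) (A : M₂ →ₗ[ℝ] M₃) (C : M₁ →ₗ[ℝ] M₂) : (r • A) ∘ₗ (s • C) = (r * s) • (A ∘ₗ C) := by
  rw [LinearMap.smul_comp, LinearMap.comp_smul, smul_smul]

omit [DecidableEq κ] in
/-- the mixed coordinate model of the zero family is zero. [folklore] -/
theorem coordOpKH_zero {S S' : Type} : coordOpKH (𝔸 := 𝔸) b (fun _ : D => (0 : (S' → 𝔸) →ₗ[ℝ] (S → 𝔸))) = 0 := by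
  apply LinearMap.ext; intro f; funext p
  simp only [coordOpKH_apply, LinearMap.zero_apply, Pi.zero_apply, map_zero, Finsupp.coe_zero]

/-- `(A ∘ B)|_ℝ = A|_ℝ ∘ B|_ℝ` on function lattices. [folklore] -/
theorem restrictScalars_comp' {S S' S'' : Type} (A : (S' → 𝔸) →ₗ[ℂ] (S → 𝔸)) (B' : (S'' → 𝔸) →ₗ[ℂ] (S' → 𝔸)) :
    (A ∘ₗ B').restrictScalars ℝ = A.restrictScalars ℝ ∘ₗ B'.restrictScalars ℝ := rfl

/-- `(A − B)|_ℝ = A|_ℝ − B|_ℝ`. [folklore] -/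
theorem restrictScalars_sub' {S S' : Type} (A B' : (S' → 𝔸) →ₗ[ℂ] (S → 𝔸)) : (A - B').restrictScalars ℝ = A.restrictScalars ℝ - B'.restrictScalars ℝ := rfl

/-- `(A + B)|_ℝ = A|_ℝ + B|_ℝ`. [folklore] -/
theorem restrictScalars_add' {S S' : Type} (A B' : (S' → 𝔸) →ₗ[ℂ] (S → 𝔸)) : (A + B').restrictScalars ℝ = A.restrictScalars ℝ + B'.restrictScalars ℝ := rfl

/-- `id|_ℝ = id`. [folklore] -/
theorem restrictScalars_id' {S : Type} : (LinearMap.id : (S → 𝔸) →ₗ[ℂ] (S → 𝔸)).restrictScalars ℝ = LinearMap.id := rfl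

/-- `0|_ℝ = 0`. [folklore] -/
theorem restrictScalars_zero' {S S' : Type} : (0 : (S' → 𝔸) →ₗ[ℂ] (S → 𝔸)).restrictScalars ℝ = 0 := rfl

omit [DecidableEq κ] in
/-- the mixed model of the identity family is the identity. [folklore] -/
theorem coordOpKH_id {S : Type} : coordOpKH (𝔸 := 𝔸) b (fun _ : D => (LinearMap.id : (S → 𝔸) →ₗ[ℝ] (S → 𝔸))) = LinearMap.id := by
  rw [coordOpKH_eq_coordOpK]; exact coordOpK_id b

end Book

/-! ## §2 `Identities 𝔬 U` at the pins -/

section Ident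

variable [Fintype SX] [Fintype SZ] [Fintype SW] [Fintype D] {g : B9.Geometry} {B : B9.Backgrounds} {Y : Type}

omit [DecidableEq κ] in
/-- ★★★ **`Identities 𝔬 U` FOR A LETTER RECORD PINNED TO THE κ-FOLD COORDINATE MODELS OF GENUINE LETTERS** (the `OpsYSectDCoords` §5 pins, letter-generic): the ten fields
`invG0'`∕`invG`∕`invG1`∕`eq126`∕`eq129`∕`eq153`∕`c1_inv`∕`h124Q`∕`h124R`∕`hR` from the corresponding identities of the genuine letters by functoriality of `coordOpK(H)` (all scalings
cancel), and `adjQ`∕`adjDv`∕`symmR` from `IsAdjTr 1 1`∕`IsSymmTr 1` over a trace-orthonormal real basis `b` of `M_N(ℂ)` (`hb`; e.g. `trBasis N`, ✓`trBasis_repr_eq_trace`).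
[cite: Balaban1985BackgroundPropagators, (3.120)–(3.130) pp.419–421, (3.124) p.420, (3.147) p.425, (3.152)–(3.153) p.426, p.393] -/
theorem identities_of_coordPins (b : Module.Basis κ ℝ (Matrix (Fin N) (Fin N) ℂ)) (hb : ∀ (v : Matrix (Fin N) (Fin N) ℂ) (k : κ), b.repr v k = (Matrix.trace ((b k)ᴴ * v)).re)
    (𝔬 : Ops g B (SX × D × κ × κ) Y (SZ × D × κ × κ) (SW × D × κ × κ)) (U : B.Cfg) {c : ℝ} (hc : c ≠ 0)
    (g0 s0 tpi t2 gt g1 gg : (SX → Matrix (Fin N) (Fin N) ℂ) →ₗ[ℂ] (SX → Matrix (Fin N) (Fin N) ℂ))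
    (q : (SX → Matrix (Fin N) (Fin N) ℂ) →ₗ[ℂ] (SZ → Matrix (Fin N) (Fin N) ℂ)) (qs : (SZ → Matrix (Fin N) (Fin N) ℂ) →ₗ[ℂ] (SX → Matrix (Fin N) (Fin N) ℂ))
    (cc c1 : (SZ → Matrix (Fin N) (Fin N) ℂ) →ₗ[ℂ] (SZ → Matrix (Fin N) (Fin N) ℂ)) (hm h1m : (SZ → Matrix (Fin N) (Fin N) ℂ) →ₗ[ℂ] (SX → Matrix (Fin N) (Fin N) ℂ))
    (dv : (SW → Matrix (Fin N) (Fin N) ℂ) →ₗ[ℂ] (SX → Matrix (Fin N) (Fin N) ℂ)) (dvs : (SX → Matrix (Fin N) (Fin N) ℂ) →ₗ[ℂ] (SW → Matrix (Fin N) (Fin N) ℂ))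
    (r : (SW → Matrix (Fin N) (Fin N) ℂ) →ₗ[ℂ] (SW → Matrix (Fin N) (Fin N) ℂ))
    -- ======== the sixteen pins ========
    (rG0 : 𝔬.G0 U = c • coordOpK b (fun _ : D => g0.restrictScalars ℝ)) (rS0 : 𝔬.S0 U = c⁻¹ • coordOpK b (fun _ : D => s0.restrictScalars ℝ))
    (rTpi : 𝔬.Tpi U = c⁻¹ • coordOpK b (fun _ : D => tpi.restrictScalars ℝ)) (rT2 : 𝔬.T2 U = c⁻¹ • coordOpK b (fun _ : D => t2.restrictScalars ℝ))
    (rG : 𝔬.G U = c • coordOpK b (fun _ : D => gt.restrictScalars ℝ)) (rG1 : 𝔬.G1 U = c • coordOpK b (fun _ : D => g1.restrictScalars ℝ))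
    (rGG : 𝔬.GG U = c • coordOpK b (fun _ : D => gg.restrictScalars ℝ))
    (rQ : 𝔬.Q U = c⁻¹ • coordOpKH b (fun _ : D => q.restrictScalars ℝ)) (rQstar : 𝔬.Qstar U = c⁻¹ • coordOpKH b (fun _ : D => qs.restrictScalars ℝ))
    (rC : 𝔬.C U = c • coordOpK b (fun _ : D => cc.restrictScalars ℝ)) (rC1 : 𝔬.C1 U = c • coordOpK b (fun _ : D => c1.restrictScalars ℝ))
    (rHm : 𝔬.Hm U = c • coordOpKH b (fun _ : D => hm.restrictScalars ℝ)) (rH1m : 𝔬.H1m U = c • coordOpKH b (fun _ : D => h1m.restrictScalars ℝ))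
    (rDv : 𝔬.Dv U = coordOpKH b (fun _ : D => dv.restrictScalars ℝ)) (rDvstar : 𝔬.Dvstar U = coordOpKH b (fun _ : D => dvs.restrictScalars ℝ))
    (rR : 𝔬.R U = c⁻¹ • coordOpK b (fun _ : D => r.restrictScalars ℝ))
    -- ======== the thirteen operator identities of the genuine letters ========
    (invG0' : g0 ∘ₗ s0 = LinearMap.id) (invG : (s0 - tpi) ∘ₗ gt = LinearMap.id) (invG1 : (s0 - (tpi + t2)) ∘ₗ g1 = LinearMap.id)
    (eq126 : hm = gt ∘ₗ qs ∘ₗ cc) (eq129 : h1m = g1 ∘ₗ qs ∘ₗ c1)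
    (eq153 : gg = g1 ∘ₗ (LinearMap.id - qs ∘ₗ c1 ∘ₗ q ∘ₗ g1 - dv ∘ₗ r ∘ₗ dvs ∘ₗ g1))
    (c1_inv : q ∘ₗ g1 ∘ₗ qs ∘ₗ c1 = LinearMap.id) (h124Q : q ∘ₗ g1 ∘ₗ dv ∘ₗ r = 0) (h124R : r ∘ₗ dvs ∘ₗ g1 ∘ₗ qs = 0)
    (hR : r ∘ₗ dvs ∘ₗ g1 ∘ₗ dv ∘ₗ r = r)
    (adjQ : IsAdjTr (fun _ => (1 : ℝ)) (fun _ => (1 : ℝ)) q qs) (adjDv : IsAdjTr (fun _ => (1 : ℝ)) (fun _ => (1 : ℝ)) dv dvs) (symmR : IsSymmTr (fun _ => (1 : ℝ)) r) :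
    Identities 𝔬 U := by
  -- composition ∕ scalar normalisation kit
  have hQ : IsTransposePair (𝔬.Q U) (𝔬.Qstar U) := by
    rw [rQ, rQstar]
    exact isTransposePair_smul (isTransposePair_coordOpKH_of_isAdjTr b hb (fun _ : D => q) (fun _ : D => qs) fun _ => adjQ) c⁻¹
  have hDv : IsTransposePair (𝔬.Dv U) (𝔬.Dvstar U) := by
    rw [rDv, rDvstar]
    exact isTransposePair_coordOpKH_of_isAdjTr b hb (fun _ : D => dv) (fun _ : D => dvs) fun _ => adjDv
  have hRt : IsTransposePair (𝔬.R U) (𝔬.R U) := by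
    rw [rR]
    exact isTransposePair_smul (isTransposePair_coordOpK_of_isSymmTr b hb r symmR) c⁻¹
  refine ⟨?_, ?_, ?_, ?_, ?_, ?_, ?_, ?_, ?_, ?_, fun f bz => hQ f bz, fun s f => hDv s f, fun s t => hRt s t⟩
  · -- invG0' : G₀ Δ_a = 1
    rw [rG0, rS0, Module.End.mul_eq_comp, smul_comp_smul, mul_inv_cancel₀ hc, one_smul, coordOpK_comp]
    simp only [← restrictScalars_comp', invG0', restrictScalars_id']
    rw [coordOpK_id]; rfl
  · -- invG : (Δ_a − Δ′_π) G = 1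
    rw [rS0, rTpi, rG, sub_mul, Module.End.mul_eq_comp, Module.End.mul_eq_comp, smul_comp_smul, smul_comp_smul, inv_mul_cancel₀ hc, one_smul, one_smul,
      coordOpK_comp, coordOpK_comp, ← Node00.OpsYSectDCoords.coordOpK_sub]
    simp only [← LinearMap.sub_comp, ← restrictScalars_sub', ← restrictScalars_comp', invG, restrictScalars_id']
    rw [coordOpK_id]; rfl
  · -- invG1 : (Δ_a − (Δ′_π + Δ⁽²⁾_π)) G₁ = 1
    rw [rS0, rTpi, rT2, rG1, sub_mul, add_mul, Module.End.mul_eq_comp, Module.End.mul_eq_comp, Module.End.mul_eq_comp, smul_comp_smul, smul_comp_smul, smul_comp_smul,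
      inv_mul_cancel₀ hc, one_smul, one_smul, one_smul, coordOpK_comp, coordOpK_comp, coordOpK_comp, ← Node00.OpsYSectDCoords.coordOpK_add,
      ← Node00.OpsYSectDCoords.coordOpK_sub]
    simp only [← LinearMap.add_comp, ← LinearMap.sub_comp, ← restrictScalars_add', ← restrictScalars_sub', ← restrictScalars_comp', invG1, restrictScalars_id']
    rw [coordOpK_id]; rfl
  · -- eq126 : H = G ∘ Q* ∘ C
    rw [rHm, rG, rQstar, rC]
    simp only [LinearMap.smul_comp, LinearMap.comp_smul, smul_smul, mul_inv_cancel₀ hc, one_smul,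
      coordOpKH_comp_coordOpK, coordOpK_comp_coordOpKH, ← restrictScalars_comp', ← eq126]
  · -- eq129 : H₁ = G₁ ∘ Q* ∘ C₁
    rw [rH1m, rG1, rQstar, rC1]
    simp only [LinearMap.smul_comp, LinearMap.comp_smul, smul_smul, mul_inv_cancel₀ hc, one_smul,
      coordOpKH_comp_coordOpK, coordOpK_comp_coordOpKH, ← restrictScalars_comp', ← eq129]
  · -- eq153 : 𝔊 = G₁ ∘ 𝔓*
    have hX : 𝔬.Qstar U ∘ₗ 𝔬.C1 U ∘ₗ 𝔬.Q U ∘ₗ 𝔬.G1 U = coordOpK b (fun _ : D => (qs ∘ₗ c1 ∘ₗ q ∘ₗ g1).restrictScalars ℝ) := by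
      rw [rQstar, rC1, rQ, rG1]
      simp only [LinearMap.smul_comp, LinearMap.comp_smul, smul_smul, mul_inv_cancel₀ hc, one_smul,
        coordOpKH_comp_coordOpK, coordOpK_comp_coordOpKH, coordOpKH_comp_coordOpKH, ← restrictScalars_comp']
      rfl
    have hY : 𝔬.Dv U ∘ₗ 𝔬.R U ∘ₗ 𝔬.Dvstar U ∘ₗ 𝔬.G1 U = coordOpK b (fun _ : D => (dv ∘ₗ r ∘ₗ dvs ∘ₗ g1).restrictScalars ℝ) := by
      rw [rDv, rR, rDvstar, rG1]
      simp only [LinearMap.smul_comp, LinearMap.comp_smul, smul_smul, mul_inv_cancel₀ hc, one_smul,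
        coordOpKH_comp_coordOpK, coordOpK_comp_coordOpKH, coordOpKH_comp_coordOpKH, ← restrictScalars_comp']
      rfl
    unfold frakPstar
    rw [hX, hY, rGG, rG1, LinearMap.smul_comp]
    congr 1
    rw [← coordOpK_id (D := D) (S := SX) b, ← Node00.OpsYSectDCoords.coordOpK_sub, ← Node00.OpsYSectDCoords.coordOpK_sub, coordOpK_comp]
    simp only [← restrictScalars_id', ← restrictScalars_sub', ← restrictScalars_comp', ← eq153]
  · -- c1_inv : Q G₁ Q* C₁ = id
    rw [rQ, rG1, rQstar, rC1]
    simp only [LinearMap.smul_comp, LinearMap.comp_smul, smul_smul, mul_inv_cancel₀ hc, one_smul,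
      coordOpKH_comp_coordOpK, coordOpK_comp_coordOpKH, coordOpKH_comp_coordOpKH, ← restrictScalars_comp', c1_inv, restrictScalars_id']
    exact coordOpKH_id b
  · -- h124Q : Q G₁ D R = 0
    rw [rQ, rG1, rDv, rR]
    simp only [LinearMap.smul_comp, LinearMap.comp_smul, smul_smul, inv_mul_cancel₀ hc, one_smul,
      coordOpKH_comp_coordOpK, coordOpK_comp_coordOpKH, coordOpKH_comp_coordOpKH, ← restrictScalars_comp', h124Q, restrictScalars_zero',
      coordOpKH_zero, smul_zero]
  · -- h124R : R D* G₁ Q* = 0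
    rw [rR, rDvstar, rG1, rQstar]
    simp only [LinearMap.smul_comp, LinearMap.comp_smul, smul_smul, inv_mul_cancel₀ hc, one_smul,
      coordOpK_comp_coordOpKH, coordOpKH_comp_coordOpKH, ← restrictScalars_comp', h124R, restrictScalars_zero',
      coordOpKH_zero, smul_zero]
  · -- hR : R D* G₁ D R = R
    rw [rR, rDvstar, rG1, rDv]
    simp only [LinearMap.smul_comp, LinearMap.comp_smul, smul_smul, inv_mul_cancel₀ hc, one_smul,
      coordOpKH_comp_coordOpK, coordOpK_comp_coordOpKH, coordOpKH_comp_coordOpKH, ← restrictScalars_comp', hR]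
    rfl

end Ident

/-! ## §3 The letter-symmetry row `hls` at the pins -/

section Symm

variable [Fintype SX] [Fintype D] {SY : Type} [Fintype SY] {g : B9.Geometry} {B : B9.Backgrounds} {Z W : Type}

omit [DecidableEq κ] in
/-- ★★ **THE LETTER-SYMMETRY ROW AT THE PINS** (`hls` of ✓`normG_row_of_evaluationRowsS` ∕ `hsym`∕`htr` of the BalabanUV knit): `S0`, `Tpi`, `T2` are self-transpose when the
genuine `Δ_a`, `Δ′_π`, `Δ⁽²⁾_π` are symmetric for the trace pairing (`IsSymmTr 1`, e.g. ✓`Prop7SectET3OpsT3HilbertRows.laplaceA_isSymmetric` read on the route carrier), and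
`(D, Dstar)` is a transpose pair when the direction-indexed families `(d ν, ds ν)` are trace-adjoint (`IsAdjTr 1 1`, (3.8)); any common scaling `cD`.
[cite: Balaban1985BackgroundPropagators, p.391, (3.8) p.392, (3.26) p.395, (3.120) p.419, (3.134) p.422] -/
theorem letterSymm_of_coordPins (b : Module.Basis κ ℝ (Matrix (Fin N) (Fin N) ℂ)) (hb : ∀ (v : Matrix (Fin N) (Fin N) ℂ) (k : κ), b.repr v k = (Matrix.trace ((b k)ᴴ * v)).re)
    (𝔬 : Ops g B (SX × D × κ × κ) (SY × D × κ × κ) Z W) (U : B.Cfg) (c cD : ℝ)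
    (s0 tpi t2 : (SX → Matrix (Fin N) (Fin N) ℂ) →ₗ[ℂ] (SX → Matrix (Fin N) (Fin N) ℂ))
    (d : D → (SX → Matrix (Fin N) (Fin N) ℂ) →ₗ[ℂ] (SY → Matrix (Fin N) (Fin N) ℂ)) (ds : D → (SY → Matrix (Fin N) (Fin N) ℂ) →ₗ[ℂ] (SX → Matrix (Fin N) (Fin N) ℂ))
    (rS0 : 𝔬.S0 U = c⁻¹ • coordOpK b (fun _ : D => s0.restrictScalars ℝ)) (rTpi : 𝔬.Tpi U = c⁻¹ • coordOpK b (fun _ : D => tpi.restrictScalars ℝ))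
    (rT2 : 𝔬.T2 U = c⁻¹ • coordOpK b (fun _ : D => t2.restrictScalars ℝ))
    (rD : 𝔬.D U = cD • coordOpKH b (fun ν => (d ν).restrictScalars ℝ)) (rDstar : 𝔬.Dstar U = cD • coordOpKH b (fun ν => (ds ν).restrictScalars ℝ))
    (hs0 : IsSymmTr (fun _ => (1 : ℝ)) s0) (htpi : IsSymmTr (fun _ => (1 : ℝ)) tpi) (ht2 : IsSymmTr (fun _ => (1 : ℝ)) t2)
    (hd : ∀ ν, IsAdjTr (fun _ => (1 : ℝ)) (fun _ => (1 : ℝ)) (d ν) (ds ν)) :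
    IsTransposePair (𝔬.S0 U) (𝔬.S0 U) ∧ IsTransposePair (𝔬.Tpi U) (𝔬.Tpi U) ∧ IsTransposePair (𝔬.T2 U) (𝔬.T2 U) ∧ IsTransposePair (𝔬.D U) (𝔬.Dstar U) := by
  rw [rS0, rTpi, rT2, rD, rDstar]
  exact ⟨isTransposePair_smul (isTransposePair_coordOpK_of_isSymmTr b hb s0 hs0) c⁻¹, isTransposePair_smul (isTransposePair_coordOpK_of_isSymmTr b hb tpi htpi) c⁻¹,
    isTransposePair_smul (isTransposePair_coordOpK_of_isSymmTr b hb t2 ht2) c⁻¹, isTransposePair_smul (isTransposePair_coordOpKH_of_isAdjTr b hb d ds hd) cD⟩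

end Symm

/-! ## §4 The positivity pin `FormSmall.posS0` at the `S0` pin -/

section Pos

variable [Fintype SX] [Fintype D]

omit [DecidableEq κ] in
/-- the quadratic form of a coordinate model is the sum over the slices `(ν, c′)` of the trace pairings of the assembled slices with their images.
[cite: Balaban1985BackgroundPropagators, p.393 (scalar products), Thm 3.11 p.416, bookkeeping] -/
theorem dotProduct_coordOpK_eq_sum (b : Module.Basis κ ℝ (Matrix (Fin N) (Fin N) ℂ)) (hb : ∀ (v : Matrix (Fin N) (Fin N) ℂ) (k : κ), b.repr v k = (Matrix.trace ((b k)ᴴ * v)).re)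
    (T : (SX → Matrix (Fin N) (Fin N) ℂ) →ₗ[ℂ] (SX → Matrix (Fin N) (Fin N) ℂ)) (f : SX × D × κ × κ → ℝ) :
    f ⬝ᵥ coordOpK b (fun _ : D => T.restrictScalars ℝ) f = ∑ ν : D, ∑ c' : κ, trIP (fun _ => (1 : ℝ)) (assembleK b ν c' f) (T (assembleK b ν c' f)) := by
  have hb' : ∀ (v : Matrix (Fin N) (Fin N) ℂ) (k : κ), b.repr v k = trReForm (b k) v := fun v k => by rw [hb, trReForm_apply]
  unfold dotProduct
  simp only [coordOpK_apply, LinearMap.coe_restrictScalars, hb']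
  rw [Fintype.sum_prod_type]
  simp only [Fintype.sum_prod_type (f := fun q : D × κ × κ => _)]
  rw [Finset.sum_comm]
  refine Finset.sum_congr rfl fun ν _ => ?_
  rw [Finset.sum_comm]
  simp only [Fintype.sum_prod_type (f := fun q : κ × κ => _)]
  rw [Finset.sum_comm]
  refine Finset.sum_congr rfl fun c' _ => ?_
  rw [Finset.sum_comm, ← sum_trReForm_eq_trIP]
  refine Finset.sum_congr rfl fun x _ => ?_
  rw [← assembleK_pairing b trReForm f x ν c']

omit [DecidableEq κ] in
/-- ★ **`PosDefEnd (𝔬.S0 U)` AT THE PIN `S0 = c⁻¹ • coordOpK b (fun _ ↦ Δ_a|_ℝ)`** from the genuine positivity `PosDefTr 1 Δ_a` (Theorem 3.11's conclusion on the regular class — at T³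
the class field `PosOnto.pos` read on the route carrier) and `0 < c`: the `FormSmall.posS0` pin. [cite: Balaban1985BackgroundPropagators, Thm 3.11 p.416] -/
theorem posDefEnd_of_coordPin (b : Module.Basis κ ℝ (Matrix (Fin N) (Fin N) ℂ)) (hb : ∀ (v : Matrix (Fin N) (Fin N) ℂ) (k : κ), b.repr v k = (Matrix.trace ((b k)ᴴ * v)).re)
    {c : ℝ} (hc : 0 < c) (s0 : (SX → Matrix (Fin N) (Fin N) ℂ) →ₗ[ℂ] (SX → Matrix (Fin N) (Fin N) ℂ)) (hpos : PosDefTr (fun _ => (1 : ℝ)) s0) :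
    PosDefEnd (c⁻¹ • coordOpK b (fun _ : D => s0.restrictScalars ℝ)) := by
  intro f hf
  rw [LinearMap.smul_apply, dotProduct_smul, smul_eq_mul, dotProduct_coordOpK_eq_sum b hb s0 f]
  refine mul_pos (inv_pos.2 hc) ?_
  -- every slice term is `≥ 0`, and some slice of a non-zero coordinate vector is non-zero
  have hnn : ∀ (ν : D) (c' : κ), 0 ≤ trIP (fun _ => (1 : ℝ)) (assembleK b ν c' f) (s0 (assembleK b ν c' f)) := by
    intro ν c'
    by_cases h0 : assembleK b ν c' f = 0
    · rw [h0, map_zero, B9Thm311ReadingCoords.trIP_zero_right]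
    · exact (hpos _ h0).le
  obtain ⟨p, hp⟩ : ∃ p, f p ≠ 0 := Function.ne_iff.mp hf
  have hA : assembleK b p.2.1 p.2.2.2 f ≠ 0 := by
    intro h0
    apply hp
    have := Node00.OpsYSectDCoords.repr_assembleK b f p.1 p.2.1 p.2.2.1 p.2.2.2
    rw [h0] at this
    simp only [Pi.zero_apply, map_zero, Finsupp.coe_zero] at this
    exact this.symm
  refine Finset.sum_pos' (fun ν _ => Finset.sum_nonneg fun c' _ => hnn ν c') ⟨p.2.1, Finset.mem_univ _, ?_⟩
  exact Finset.sum_pos' (fun c' _ => hnn _ c') ⟨p.2.2.2, Finset.mem_univ _, hpos _ hA⟩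

end Pos

end Summit.QuantumFields.YangMills.Theorems.Prop7SectET3OpsCoordPins

end
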